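import Summits.BirchSwinnertonDyer.BirchSwinnertonDyer.Theorems.ThetaPartnerAtTwoSignedKatoUpToAtTwoLayerSideNoPTOfCore
import Summits.BirchSwinnertonDyer.BirchSwinnertonDyer.Theorems.ThetaPartnerAtTwoSignedKatoUpToAtTwoOffTwoESClass
import Summits.BirchSwinnertonDyer.BirchSwinnertonDyer.Theorems.ThetaPartnerAtTwoSignedMainConjectureCMTwoRankZeroStubPlusHondaSystemCMTwo
import Literature.NumberTheory.EllipticCurves.CyclotomicZpExtensionLocalGeneratorProofs
import HarnessLib

/-!
# Route `ThetaPartnerAtTwo` (TP2), crux K3 `SignedKatoDivisibilityUpToAtTwo` (stmt-BirchSwinnertonDyer-20308) / K3P′ (25631), line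
# `colemanrat` v10 — INSTRUMENT ROW: the registered PUB stub CORE (`stub_katoZetaErlTwo`) MINUS its explicit-reciprocity clause (ERL♭)
# is a tree theorem (modulo Kato's construction fact), with a NON-ZERO Euler-system class

Width seat `bsd-wall-tp2-p2x-w3` g5 (cell `bsd-wall`). HONEST FRAMING: ONE theorem, a composition of tree theorems; CONDITIONAL on the
displayed construction fact `Kato2004.exists_eulerSystem_expStar_values` (Kato (8.1.3)/Ex. 13.3, def:Prop, no `_holds`); no definition, no
named fact declared, no instance, no `sorry`; closes nothing; K3/K3P′ NOT settled; BSD is NOT proved by any of this.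

## What it says (non-vacuity / localisation of content)

CORE = the hypothesis `hcore` of `NoPTOfCore.layerSideNoPTTwo_of_core` (= the lead's registered v10 stub `stub_katoZetaErlTwo`): for the
habitat data, `v ∋ 2`, height-one `𝔭 ∌ 2`, every pinned `I` and every `pair` with (P1)(P2)(P3): «∃ local lift `g`, plus Honda system `d`
((L)(TR)(GEN)(GEN₀)), class `s ∈ I.H` with (ES) `IsEulerSystemClassTwo W hκ I s` ∧ (ERL♭)».  THIS FILE proves the same statement with
(ERL♭) replaced by `s ≠ 0` — `NoPTOfCore.coreSansErl_of_expStarValues` — from: a local lift of the generator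
(`ZpExtension.IsCyclotomic.exists_isTopGenerator_resGalOfEmb_adicCompletion`), HONDA⁺@2 (`SignedEC.PlusLayer.plusHondaSystemTwo_adicCompletion`,
Kobayashi §8.4 at `2`, tree), and a NON-ZERO genuine `2`-adic Euler-system class on the habitat (`ESClassTwo.exists_isEulerSystemClassTwo_ne_zero_of_goodSS`:
Kato's `(c,d)`-zeta family lifted to `𝐇¹`, non-zero because `L(E,1) ≠ 0` at `r_an = 0` and `E[2]` is irreducible at a good supersingular `2`).
Consequently ALL the content of CORE is its (ERL♭) conjunct — and (ERL♭) is never vacuous either: for every `g`, `d` with (L)(TR) every functional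
has a unique Coleman pair at `2` (`ColemanLinear.exists_colemanLinearMap_two`).  The hypotheses (P1)(P2)(P3) on `pair` are not used (they are
satisfiable: `LayerPairing.exists_linear_layerPairing`).

References: [Kato2004Asterisque] (8.1.3), Ex. 13.3, Thm. 12.5; [Kobayashi2003] §8.4 (Lemma 8.9, Props. 8.11–8.12); [Sprung2012] Def. 5.9, Prop. 5.7.
-/

set_option autoImplicit false
-- the Theorems namespace of this sub repeats the summit name by design (D-0017 nested layout)
set_option linter.dupNamespace false

noncomputable section

open scoped Classical MatrixGroups ModularForm NumberField

open CongruenceSubgroup WeierstrassCurve Field IsDedekindDomain NumberField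
  Literature.NumberTheory.GaloisRepresentations
  Literature.NumberTheory.EllipticCurves Literature.NumberTheory.EllipticCurves.ModularForms
  Literature.NumberTheory.EllipticCurves.Module Literature.NumberTheory.EllipticCurves.Rank1Residual
  Literature.NumberTheory.EllipticCurves.Kobayashi2003 Literature.NumberTheory.EllipticCurves.Kato2004
  Literature.NumberTheory.EllipticCurves.Kato2004.EulerSystemValues Literature.NumberTheory.EllipticCurves.GreenbergSelmer
  Literature.NumberTheory.EllipticCurves.Sprung2012
  ZpExtension Summit.BirchSwinnertonDyer.Rank1Residual.Supersingular

namespace Summit.BirchSwinnertonDyer.BirchSwinnertonDyer.Theorems.SignedKatoOffTwo.NoPTOfCore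

/-- **CORE minus (ERL♭) holds, with `s ≠ 0`, granted Kato's construction fact.** Same binders as CORE (`stub_katoZetaErlTwo`); conclusion:
a local lift `g` of the topological generator, a plus Honda system `d` with (L)(TR)(GEN)(GEN₀), and a NON-ZERO genuine `2`-adic
Euler-system class `s ∈ I.H`. Proof: `exists_isTopGenerator_resGalOfEmb_adicCompletion` + `SignedEC.PlusLayer.plusHondaSystemTwo_adicCompletion`
+ `ESClassTwo.exists_isEulerSystemClassTwo_ne_zero_of_goodSS`. So the content of CORE is exactly its (ERL♭) conjunct (Kato Thm. 12.5 +
Kobayashi Thm. 6.3 at `2`). CONDITIONAL on `hES`; closes nothing. [cite: Kato2004Asterisque, (8.1.3) (p. 180), Ex. 13.3 (p. 225), Thm. 12.5 (p. 222)]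
[cite: Kobayashi2003, Lemma 8.9, Prop. 8.11, Prop. 8.12 (pp. 16–18)] [cite: Washington1997, §13.1] -/
theorem coreSansErl_of_expStarValues (hES : Kato2004.exists_eulerSystem_expStar_values) :
    ∀ (v : HeightOneSpectrum (𝓞 ℚ)), ((2 : ℕ) : 𝓞 ℚ) ∈ v.asIdeal →
    ∀ (W : WeierstrassCurve ℚ) [W.IsElliptic] [W.IsGloballyMinimal],
      ¬ W.HasCM → W.analyticRank = 0 → GoodSS W 2 → W.frobeniusTrace 2 = 0 →
      ∀ (κ : ZpExtension ℚ 2) (γ : Field.absoluteGaloisGroup ℚ) (hκ : κ.IsCyclotomic),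
        κ.IsTopGenerator γ → IsCyclotomicVariable 2 γ →
        ∀ [NeZero (W.conductorNorm ℤ)] (f : CuspForm (Gamma0 (W.conductorNorm ℤ)) 2),
          IsNewformOf W f → ∀ (ϖ : ℚ), (ϖ : ℝ) * W.realPeriodRat = plusPeriod f →
        ∀ (Lplus Lminus : IwasawaAlgebra 2), IsPollackPair f 2 Lplus Lminus →
        ∀ [ContinuousSMul ℤ_[2] (W.tateModule 2)] [Module.Free ℤ_[2] (W.tateModule 2)]
          [Module.Finite ℤ_[2] (W.tateModule 2)],
        ∀ 𝔭 : PrimeSpectrum (IwasawaAlgebra 2), 𝔭.asIdeal.height = 1 →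
          PowerSeries.C (2 : ℤ_[2]) ∉ 𝔭.asIdeal →
        ∀ (I : Kato2004.IwasawaH1Data W 2 κ γ)
          (pair : ∀ n : ℕ, H1 (tateRep W 2) (κ.layerSubgroup n) →ₗ[ℤ_[2]]
            (localLayerPointsOfEmb κ (closureEmb (K := ℚ) (v.adicCompletion ℚ)) W n →+ ℤ_[2])),
          -- (P1) projection formula
          (∀ (n : ℕ) (x : H1 (tateRep W 2) (κ.layerSubgroup (n + 1))) (Q : localPoints W (v.adicCompletion ℚ))
            (hQ : Q ∈ localLayerPointsOfEmb κ (closureEmb (K := ℚ) (v.adicCompletion ℚ)) W n),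
            pair n (layerCores (tateRep W 2) κ n x) ⟨Q, hQ⟩ =
              pair (n + 1) x ⟨Q, localLayerPointsOfEmb_mono κ (closureEmb (K := ℚ) (v.adicCompletion ℚ)) W (Nat.le_succ n) hQ⟩) →
          -- (P2) Galois invariance, for EVERY `g ∈ Γ_v`
          (∀ (n : ℕ) (g : absoluteGaloisGroup (v.adicCompletion ℚ)) (y : H1 (tateRep W 2) (κ.layerSubgroup n))
            (Q : localPoints W (v.adicCompletion ℚ))
            (hQ : Q ∈ localLayerPointsOfEmb κ (closureEmb (K := ℚ) (v.adicCompletion ℚ)) W n),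
            pair n (conjMap (tateRep W 2).toTopRep (κ.layerSubgroup n) (resGalOfEmb (closureEmb (K := ℚ) (v.adicCompletion ℚ)) g) 1 y)
              ⟨g • Q, smul_mem_localLayerPointsOfEmb κ (closureEmb (K := ℚ) (v.adicCompletion ℚ)) W n g hQ⟩ = pair n y ⟨Q, hQ⟩) →
          -- (P3) `pair` IS the `T₂E`-adic local Tate pairing: residues = the (D-layer) pairings for THE Weil pairings of the tree
          (∀ (n k : ℕ) (x : H1 (tateRep W 2) (κ.layerSubgroup n))
            (Q : localLayerPointsOfEmb κ (closureEmb (K := ℚ) (v.adicCompletion ℚ)) W n),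
            PadicInt.toZModPow k (pair n x Q) =
              LayerPairing.layerPairingPk W κ v (LayerPairing.weilTowerPk W) (LayerPairing.weilTowerPk_pow W)
                (LayerPairing.weilTowerPk_add_left W) (LayerPairing.weilTowerPk_add_right W) (LayerPairing.weilTowerPk_smul W)
                n k x Q) →
        ∃ (g : absoluteGaloisGroup (v.adicCompletion ℚ))
          (_ : κ.IsTopGenerator (resGalOfEmb (closureEmb (K := ℚ) (v.adicCompletion ℚ)) g))
          (d : ℕ → localPoints W (v.adicCompletion ℚ)) (s : I.H),
          (∀ n, d n ∈ localLayerPointsOfEmb κ (closureEmb (K := ℚ) (v.adicCompletion ℚ)) W n) ∧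
          (∀ n, localTraceOfEmb κ (closureEmb (K := ℚ) (v.adicCompletion ℚ)) W (n + 1) (n + 2) (d (n + 2)) = -d n) ∧
          (∀ n : ℕ, 1 ≤ n → ∀ P ∈ localLayerPointsOfEmb κ (closureEmb (K := ℚ) (v.adicCompletion ℚ)) W n,
            ∃ B ∈ AddSubgroup.closure (Set.range fun σ : absoluteGaloisGroup (v.adicCompletion ℚ) ↦ σ • d n),
              ∃ P' ∈ localLayerPointsOfEmb κ (closureEmb (K := ℚ) (v.adicCompletion ℚ)) W (n - 1),
              ∃ R ∈ localLayerPointsOfEmb κ (closureEmb (K := ℚ) (v.adicCompletion ℚ)) W n, P = B + P' + 2 • R) ∧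
          (∀ P ∈ localLayerPointsOfEmb κ (closureEmb (K := ℚ) (v.adicCompletion ℚ)) W 0,
            ∃ a : ℤ, ∃ R ∈ localLayerPointsOfEmb κ (closureEmb (K := ℚ) (v.adicCompletion ℚ)) W 0, P = a • d 0 + 2 • R) ∧
          Kato2004.IsEulerSystemClassTwo W hκ I s ∧ s ≠ 0 := by
  intro v hv W _ _ _ hr hss ha κ γ hκ hγ _ _ f hf _ _ _ _ _ _ _ _ 𝔭 _ _ I _ _ _ _
  -- a local lift of the topological generator
  obtain ⟨g, hg⟩ := hκ.exists_isTopGenerator_resGalOfEmb_adicCompletion v hv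
  -- HONDA⁺@2 (tree theorem)
  have hv' : (2 : 𝓞 ℚ) ∈ v.asIdeal := by exact_mod_cast hv
  obtain ⟨d, hL, hTR, hGEN, hGEN0⟩ := SignedEC.PlusLayer.plusHondaSystemTwo_adicCompletion W hss ha κ hκ v hv'
  -- a non-zero genuine `2`-adic Euler-system class (Kato's zeta family, modulo the construction fact)
  obtain ⟨s, hs, hs0⟩ := ESClassTwo.exists_isEulerSystemClassTwo_ne_zero_of_goodSS W hκ hES hr hss f hf I
  exact ⟨g, hg, d, s, hL, hTR, hGEN, hGEN0, hs, hs0⟩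

end Summit.BirchSwinnertonDyer.BirchSwinnertonDyer.Theorems.SignedKatoOffTwo.NoPTOfCore

end
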